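import Mathlib
import Summits.ValiantsHypothesis.ValiantsHypothesis.Theorems.BarrierLeverPartitionMinorsHitByVPHiddenStatesCoreLift
import Summits.ValiantsHypothesis.ValiantsHypothesis.Theorems.BarrierLeverPartitionMinorsHitByVPHiddenStatesAddRowFree

/-!
# Route BarrierLever — item `PartitionMinorsHitByVP` (stmt-ValiantsHypothesis-19717), line `hidden-states`:
# CORE-FREE DOUBLING — a lower cell `(n, 2^n − c)` lifts to `(n + 1, 2^{n+1} − c)` for EVERY co-size `c`, at the price of `c` free points

Helper file (`--supports stmt-ValiantsHypothesis-19717`; cell valiant-natproofs, rung V4, 𝒟-side door (c), registered line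
`Cruxes/PartitionMinorsHitByVP/Lines/hidden_states.lean` v8; prover seat val-np-p6 gen 14). Definition-free; closes NO item.

THE POINT. The core lift (`SymbJoin.symGood_lift`, p625816) needs a CORE coordinate and therefore stops at co-size `c = h + 1`
(the diagonal cells, p634848). Here the core hypothesis is removed. Let `U ⊆ 2^{[n+1]}` be a down-set of co-size `c` and `x` ANY
coordinate. The link `𝓛 = {S ⊆ [n+1] ∖ x : S ∪ {x} ∈ U}` is a down-set with at least `2^n − c` members, and every member `S` of it
lies in `U` as well. Trim `𝓛` to a down-set `L′` of size EXACTLY `2^n − c` (remove maximal members, `exists_lower_subfamily`). Then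
`U ⊇ L′ × {∅, {x}}` — a CYLINDER over a down-set of co-size `c` one dimension lower — and the remainder `U ∖ (L′ × {∅,{x}})` has
exactly `(2^{n+1} − c) − 2(2^n − c) = c` rows, WHATEVER they are. So the design «old design DOUBLED by a marker state
(`SymbJoin.symGood_cylinder`, p610391) ⊔ `c` affinely free columns (free points absorb arbitrary rows, `SymbJoin.symGood_goodCore_free`,
p603992)» is generically good for `U` as soon as the old design is generically good for every down-set of size `2^n − c` in dimension `n`.

* `exists_lower_subfamily` — a finite down-set family of sets has a down-set subfamily of every smaller size.
* **`symGood_double_free`** — the symbolic doubling theorem (any enumerations of the three column blocks: old columns, marked old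
  columns, free columns).

The numeric node form with explicit piece/state budgets (`m ↦ m + s`, `K ↦ K + 1`, `c ≤ s(K+2)` free points carried by `s` star
pieces) and its iteration — the LOWER node at `(h, 2^h − c)` for every `h` and every `c ≤ 2h³ − 2h + 2`, closing the `h = 19` window —
are in the sequels `…HiddenStatesCoHubLift` / `…HiddenStatesCoHubCells`.

WHAT THIS IS NOT: free points cost `c` columns per dimension step, so the method is polynomial in reach (`c = O(h³)` under the
`m ≤ 2h`, `K ≤ h³` budget) and says nothing in the bulk `4h⁴ < r < 2^h − 2h³`; no stub of the line is closed; nothing on crux 14610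
or VP ≠ VNP.
-/

set_option linter.dupNamespace false

namespace Summit.ValiantsHypothesis.ValiantsHypothesis.Theorems.BarrierLever.HiddenStates

open Finset Matrix MvPolynomial

noncomputable section

namespace SymbJoin

variable {h m K r : ℕ}

/-! ## 1. Trimming a down-set family -/

/-- **A finite down-set family of finite sets has a down-set subfamily of every size below its own** (remove a member of maximal
cardinality, which is a maximal member, and recurse). -/
theorem exists_lower_subfamily {α : Type*} [DecidableEq α] (d : ℕ) :
    ∀ (L : Finset (Finset α)), (∀ S ∈ L, ∀ T, T ⊆ S → T ∈ L) → ∀ k, L.card = k + d →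
      ∃ L' : Finset (Finset α), L' ⊆ L ∧ L'.card = k ∧ ∀ S ∈ L', ∀ T, T ⊆ S → T ∈ L' := by
  induction d with
  | zero => intro L hL k hk; exact ⟨L, subset_rfl, by simpa using hk, hL⟩
  | succ d ih =>
    intro L hL k hk
    have hne : L.Nonempty := by rw [← Finset.card_pos]; omega
    obtain ⟨S₀, hS₀, hmax⟩ := Finset.exists_max_image L Finset.card hne
    have hL' : ∀ S ∈ L.erase S₀, ∀ T, T ⊆ S → T ∈ L.erase S₀ := by
      intro S hS T hTS
      obtain ⟨hSne, hSL⟩ := Finset.mem_erase.mp hS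
      refine Finset.mem_erase.mpr ⟨?_, hL S hSL T hTS⟩
      rintro rfl
      exact hSne (Finset.eq_of_subset_of_card_le hTS (hmax S hSL)).symm
    obtain ⟨L', hL'sub, hcard, hlow⟩ := ih (L.erase S₀) hL' k (by rw [Finset.card_erase_of_mem hS₀]; omega)
    exact ⟨L', hL'sub.trans (Finset.erase_subset _ _), hcard, hlow⟩

/-! ## 2. The symbolic doubling theorem -/

/-- **CORE-FREE DOUBLING (symbolic form).** Let `e` (columns `Fin r₁`) be generically good for every injective LOWER row family of
`r₁` subsets of `Fin n`, where `r₁ + c = 2^n`. Let `u` be an injective lower family of `r = r₁ + r₁ + c` subsets of `Fin (n+1)` and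
`x` any coordinate. Let the design `e'` consist of: the columns of `e` re-indexed along `(ι, κ)` (block `g₀`); the same columns with
the marker state `mk ∉ range κ` added (block `g₁`); and `c` further columns, each affinely free among the columns of its piece
(block `g₂`), the three blocks enumerating `Fin r` injectively. Then `(u, e')` is generically good. -/
theorem symGood_double_free {n r₁ c m' K' : ℕ} (e : Fin r₁ → Fin m × Finset (Fin K))
    (hgood : ∀ w : Fin r₁ → Finset (Fin n), Function.Injective w → IsLowerSet (Set.range w) → symDet w e ≠ 0)
    (hn : r₁ + c = 2 ^ n)
    (u : Fin r → Finset (Fin (n + 1))) (hu : Function.Injective u) (hlow : IsLowerSet (Set.range u))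
    (hr : r₁ + r₁ + c = r) (x : Fin (n + 1))
    (e' : Fin r → Fin m' × Finset (Fin K'))
    (g₀ g₁ : Fin r₁ → Fin r) (g₂ : Fin c → Fin r)
    (hg : Function.Injective (Sum.elim (Sum.elim g₀ g₁) g₂))
    (ι : Fin m ↪ Fin m') (κ : Fin K ↪ Fin K') (mk : Fin K') (hmk : mk ∉ Set.range κ)
    (he0 : ∀ j, e' (g₀ j) = (ι (e j).1, ((e j).2).map κ))
    (he1 : ∀ j, e' (g₁ j) = (ι (e j).1, insert mk (((e j).2).map κ)))
    (hfree : ∀ j, ∃ cc : Option (Fin K') → ℂ, phi cc (e' (g₂ j)).2 = 1 ∧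
      ∀ k', k' ≠ g₂ j → (e' k').1 = (e' (g₂ j)).1 → phi cc (e' k').2 = 0) :
    symDet u e' ≠ 0 := by
  classical
  -- ### the link family through `x`
  set emb : Fin n ↪ Fin (n + 1) := Fin.succAboveEmb x with hemb
  have hxemb : ∀ S : Finset (Fin n), x ∉ S.map emb := by
    intro S hx
    obtain ⟨a, -, ha⟩ := Finset.mem_map.mp hx
    exact Fin.succAbove_ne x a ha
  set 𝓛 : Finset (Finset (Fin n)) := Finset.univ.filter fun S => insert x (S.map emb) ∈ Set.range u with h𝓛
  have h𝓛low : ∀ S ∈ 𝓛, ∀ T, T ⊆ S → T ∈ 𝓛 := by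
    intro S hS T hTS
    simp only [h𝓛, Finset.mem_filter, Finset.mem_univ, true_and] at hS ⊢
    obtain ⟨i, hi⟩ := hS
    have hsub : insert x (T.map emb) ⊆ u i := by
      rw [hi]; exact Finset.insert_subset_insert x (Finset.map_subset_map.mpr hTS)
    exact hlow hsub ⟨i, rfl⟩
  have h𝓛card : r₁ ≤ 𝓛.card := by
    have hinj : Set.InjOn (fun S : Finset (Fin n) => insert x (S.map emb)) ↑(Finset.univ \ 𝓛) := by
      intro S _ T _ hST
      have h1 : (insert x (S.map emb)).erase x = (insert x (T.map emb)).erase x := by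
        simp only at hST; rw [hST]
      rw [Finset.erase_insert (hxemb S), Finset.erase_insert (hxemb T)] at h1
      exact Finset.map_injective emb h1
    have hmaps : ∀ S ∈ Finset.univ \ 𝓛,
        (fun S : Finset (Fin n) => insert x (S.map emb)) S ∈ Finset.univ \ Finset.univ.image u := by
      intro S hS
      rw [Finset.mem_sdiff] at hS ⊢
      refine ⟨Finset.mem_univ _, fun hmem => hS.2 ?_⟩
      simp only [h𝓛, Finset.mem_filter, Finset.mem_univ, true_and]
      obtain ⟨i, -, hi⟩ := Finset.mem_image.mp hmem
      exact ⟨i, hi⟩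
    have hle := Finset.card_le_card_of_injOn _ hmaps hinj
    have hA : (Finset.univ \ 𝓛).card = 2 ^ n - 𝓛.card := by
      rw [Finset.card_sdiff_of_subset (Finset.subset_univ _), Finset.card_univ, Fintype.card_finset, Fintype.card_fin]
    have hB : (Finset.univ \ Finset.univ.image u).card = 2 ^ (n + 1) - r := by
      rw [Finset.card_sdiff_of_subset (Finset.subset_univ _), Finset.card_univ, Fintype.card_finset, Fintype.card_fin,
        Finset.card_image_of_injective _ hu, Finset.card_univ, Fintype.card_fin]
    have h𝓛le : 𝓛.card ≤ 2 ^ n := by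
      have := Finset.card_le_univ 𝓛
      rwa [Fintype.card_finset, Fintype.card_fin] at this
    rw [hA, hB, pow_succ] at hle
    omega
  -- ### trim it to a down-set of size exactly `r₁`
  obtain ⟨L', hL'sub, hL'card, hL'low⟩ := exists_lower_subfamily (𝓛.card - r₁) 𝓛 h𝓛low r₁ (by omega)
  have hL'c : Fintype.card L' = r₁ := by rw [Fintype.card_coe, hL'card]
  let ε : L' ≃ Fin r₁ := Fintype.equivFinOfCardEq hL'c
  let w : Fin r₁ → Finset (Fin n) := fun j => (ε.symm j).1
  have hwmem : ∀ j, w j ∈ L' := fun j => (ε.symm j).2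
  have hwinj : Function.Injective w := fun j j' hjj => ε.symm.injective (Subtype.ext hjj)
  have hwsurj : ∀ S ∈ L', ∃ j, w j = S := fun S hS => ⟨ε ⟨S, hS⟩, by simp [w]⟩
  have hwlow : IsLowerSet (Set.range w) := by
    rintro S T hTS ⟨j, rfl⟩
    exact hwsurj T (hL'low (w j) (hwmem j) T hTS)
  -- ### the old design serves `w`; transport to dimension `n + 1` and to the new pieces/states
  let w' : Fin r₁ → Finset (Fin (n + 1)) := fun j => (w j).map emb
  let ee : Fin r₁ → Fin m' × Finset (Fin K') := fun k => (ι (e k).1, ((e k).2).map κ)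
  have hG : symDet w' ee ≠ 0 :=
    symGood_map_pieces ι κ w' e (symGood_map_embedding emb w e (hgood w hwinj hwlow))
  -- ### the cylinder `w' × {∅,{x}}` is served by the doubled design
  let ucyl : Fin (r₁ + r₁) → Finset (Fin (n + 1)) := Fin.append w' fun j => insert x (w' j)
  let ecyl : Fin (r₁ + r₁) → Fin m' × Finset (Fin K') := Fin.append ee fun j => ((ee j).1, insert mk (ee j).2)
  have hcast : Function.Injective (Sum.elim (Fin.castAdd r₁ : Fin r₁ → Fin (r₁ + r₁)) (Fin.natAdd r₁)) := by
    have : Sum.elim (Fin.castAdd r₁ : Fin r₁ → Fin (r₁ + r₁)) (Fin.natAdd r₁) = ⇑(finSumFinEquiv (m := r₁) (n := r₁)) := by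
      funext i; rcases i with i | i <;> simp
    rw [this]; exact finSumFinEquiv.injective
  have hcyl : symDet ucyl ecyl ≠ 0 := by
    refine symGood_cylinder w' ee x (fun _ => mk) (fun j => hxemb (w j)) ?_ ucyl ecyl rfl
      (Fin.castAdd r₁) (Fin.natAdd r₁) hcast ?_ ?_ ?_ ?_ hG
    · intro k hk
      obtain ⟨q, -, hq⟩ := Finset.mem_map.mp hk
      exact hmk ⟨q, hq⟩
    · intro j; exact Fin.append_left _ _ j
    · intro j; exact Fin.append_right _ _ j
    · intro j; exact Fin.append_left _ _ j
    · intro j; exact Fin.append_right _ _ j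
  -- ### the cylinder sits inside `(u, e')`
  have hrow1 : ∀ j, ∃ i, u i = insert x (w' j) := by
    intro j
    have := hL'sub (hwmem j)
    simp only [h𝓛, Finset.mem_filter, Finset.mem_univ, true_and] at this
    exact this
  have hrow0 : ∀ j, ∃ i, u i = w' j := by
    intro j
    obtain ⟨i, hi⟩ := hrow1 j
    exact hlow (Finset.subset_insert x (w' j)) ⟨i, hi⟩
  choose ρ₀ hρ₀ using hrow0
  choose ρ₁ hρ₁ using hrow1
  let row : Fin (r₁ + r₁) → Fin r := Fin.append ρ₀ ρ₁
  have hrow : Function.Injective row := by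
    refine Fin.append_injective_iff.mpr ⟨?_, ?_, ?_⟩
    · intro j j' hjj
      apply hwinj
      apply Finset.map_injective emb
      change w' j = w' j'
      rw [← hρ₀ j, ← hρ₀ j', hjj]
    · intro j j' hjj
      apply hwinj
      apply Finset.map_injective emb
      change w' j = w' j'
      have h1 : insert x (w' j) = insert x (w' j') := by rw [← hρ₁ j, ← hρ₁ j', hjj]
      have h2 := congrArg (fun S => Finset.erase S x) h1
      have hxj : x ∉ w' j := hxemb (w j)
      have hxj' : x ∉ w' j' := hxemb (w j')
      simpa only [Finset.erase_insert hxj, Finset.erase_insert hxj'] using h2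
    · intro j j' hjj
      have h1 : x ∈ u (ρ₁ j') := by rw [hρ₁]; exact Finset.mem_insert_self _ _
      rw [← hjj, hρ₀] at h1
      exact hxemb (w j) h1
  let col : Fin (r₁ + r₁) → Fin r := Fin.append g₀ g₁
  have hg01 : Function.Injective (Sum.elim g₀ g₁) := fun a b hab => Sum.inl_injective (hg (a₁ := Sum.inl a) (a₂ := Sum.inl b) hab)
  have hcol : Function.Injective col := by
    refine Fin.append_injective_iff.mpr ⟨?_, ?_, ?_⟩
    · exact fun a b hab => Sum.inl_injective (hg01 (a₁ := Sum.inl a) (a₂ := Sum.inl b) hab)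
    · exact fun a b hab => Sum.inr_injective (hg01 (a₁ := Sum.inr a) (a₂ := Sum.inr b) hab)
    · intro a b hab
      exact Sum.inl_ne_inr (hg01 (a₁ := Sum.inl a) (a₂ := Sum.inr b) hab)
  have hcore : symDet (fun c => u (row c)) (fun c => e' (col c)) ≠ 0 := by
    have hu' : (fun c => u (row c)) = ucyl := by
      funext k
      rcases eq_castAdd_or_natAdd k with ⟨j, rfl⟩ | ⟨j, rfl⟩
      · change u (Fin.append ρ₀ ρ₁ (Fin.castAdd r₁ j)) = Fin.append w' (fun j => insert x (w' j)) (Fin.castAdd r₁ j)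
        rw [Fin.append_left, Fin.append_left, hρ₀]
      · change u (Fin.append ρ₀ ρ₁ (Fin.natAdd r₁ j)) = Fin.append w' (fun j => insert x (w' j)) (Fin.natAdd r₁ j)
        rw [Fin.append_right, Fin.append_right, hρ₁]
    have he' : (fun c => e' (col c)) = ecyl := by
      funext k
      rcases eq_castAdd_or_natAdd k with ⟨j, rfl⟩ | ⟨j, rfl⟩
      · change e' (Fin.append g₀ g₁ (Fin.castAdd r₁ j)) = Fin.append ee (fun j => ((ee j).1, insert mk (ee j).2)) (Fin.castAdd r₁ j)
        rw [Fin.append_left, Fin.append_left, he0]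
      · change e' (Fin.append g₀ g₁ (Fin.natAdd r₁ j)) = Fin.append ee (fun j => ((ee j).1, insert mk (ee j).2)) (Fin.natAdd r₁ j)
        rw [Fin.append_right, Fin.append_right, he1]
    rw [hu', he']
    exact hcyl
  -- ### free points absorb the remaining `c` rows
  refine symGood_goodCore_free u hu e' row col hrow hcol hcore ?_
  intro k hk
  -- `k` is a free column
  have hbij : Function.Bijective (Sum.elim (Sum.elim g₀ g₁) g₂) := by
    rw [Fintype.bijective_iff_injective_and_card]
    exact ⟨hg, by simp [Fintype.card_sum]; omega⟩
  obtain ⟨s, hs⟩ := hbij.2 k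
  rcases s with (j | j) | j
  · exact absurd ⟨Fin.castAdd r₁ j, by change Fin.append g₀ g₁ _ = k; rw [Fin.append_left]; exact hs⟩ hk
  · exact absurd ⟨Fin.natAdd r₁ j, by change Fin.append g₀ g₁ _ = k; rw [Fin.append_right]; exact hs⟩ hk
  · simp only [Sum.elim_inr] at hs
    subst hs
    exact hfree j

/-! ## 3. The same for ARBITRARY injective row families (appended, val-np-p6 g14)

No lower-set hypothesis: for any injective `u` of size `2^{n+1} − c` and any `x`, deletion `𝓓` and link `𝓛` satisfy
`|𝓓| + |𝓛| ≥ |U|`, so `|𝓓 ∩ 𝓛| ≥ 2^n − c`: `U` ⊇ a cylinder over an ARBITRARY family of size `2^n − c` plus exactly `c` rows. -/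
/-- **CORE-FREE DOUBLING for arbitrary injective families (symbolic form).** As `symGood_double_free`, with the lower-set
hypotheses on both sides removed: the old design is assumed generically good for EVERY injective family of `r₁` subsets of
`Fin n`, and the conclusion holds for EVERY injective `u`. -/
theorem symGood_double_free_all {n r₁ c m' K' : ℕ} (e : Fin r₁ → Fin m × Finset (Fin K))
    (hgood : ∀ w : Fin r₁ → Finset (Fin n), Function.Injective w → symDet w e ≠ 0)
    (hn : r₁ + c = 2 ^ n)
    (u : Fin r → Finset (Fin (n + 1))) (hu : Function.Injective u)
    (hr : r₁ + r₁ + c = r) (x : Fin (n + 1))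
    (e' : Fin r → Fin m' × Finset (Fin K'))
    (g₀ g₁ : Fin r₁ → Fin r) (g₂ : Fin c → Fin r)
    (hg : Function.Injective (Sum.elim (Sum.elim g₀ g₁) g₂))
    (ι : Fin m ↪ Fin m') (κ : Fin K ↪ Fin K') (mk : Fin K') (hmk : mk ∉ Set.range κ)
    (he0 : ∀ j, e' (g₀ j) = (ι (e j).1, ((e j).2).map κ))
    (he1 : ∀ j, e' (g₁ j) = (ι (e j).1, insert mk (((e j).2).map κ)))
    (hfree : ∀ j, ∃ cc : Option (Fin K') → ℂ, phi cc (e' (g₂ j)).2 = 1 ∧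
      ∀ k', k' ≠ g₂ j → (e' k').1 = (e' (g₂ j)).1 → phi cc (e' k').2 = 0) :
    symDet u e' ≠ 0 := by
  classical
  -- ### deletion and link through `x`
  set emb : Fin n ↪ Fin (n + 1) := Fin.succAboveEmb x with hemb
  have hxemb : ∀ S : Finset (Fin n), x ∉ S.map emb := by
    intro S hx
    obtain ⟨a, -, ha⟩ := Finset.mem_map.mp hx
    exact Fin.succAbove_ne x a ha
  set 𝓓 : Finset (Finset (Fin n)) := Finset.univ.filter fun S => S.map emb ∈ Set.range u with h𝓓
  set 𝓛 : Finset (Finset (Fin n)) := Finset.univ.filter fun S => insert x (S.map emb) ∈ Set.range u with h𝓛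
  -- every row is `S.map emb` or `insert x (S.map emb)` for exactly one `S`
  have hpull : ∀ i, ∃ S : Finset (Fin n), u i = S.map emb ∨ u i = insert x (S.map emb) := by
    intro i
    let S : Finset (Fin n) := Finset.univ.filter fun a => emb a ∈ u i
    have hS : S.map emb = (u i).erase x := by
      ext b
      simp only [Finset.mem_map, Finset.mem_filter, Finset.mem_univ, true_and, Finset.mem_erase, S]
      constructor
      · rintro ⟨a, ha, rfl⟩; exact ⟨Fin.succAbove_ne x a, ha⟩
      · rintro ⟨hb, hbu⟩
        obtain ⟨a, rfl⟩ := Fin.exists_succAbove_eq hb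
        exact ⟨a, hbu, rfl⟩
    by_cases hx : x ∈ u i
    · exact ⟨S, Or.inr (by rw [hS, Finset.insert_erase hx])⟩
    · exact ⟨S, Or.inl (by rw [hS, Finset.erase_eq_of_notMem hx])⟩
  have hcard : r ≤ 𝓓.card + 𝓛.card := by
    -- every row is the image of a member of `𝓓 ⊕ 𝓛` under `inl S ↦ S.map emb`, `inr S ↦ insert x (S.map emb)`
    let g : Finset (Fin n) ⊕ Finset (Fin n) → Finset (Fin (n + 1)) :=
      fun s => Sum.elim (fun S => S.map emb) (fun S => insert x (S.map emb)) s
    have hsub : Finset.univ.image u ⊆ (𝓓.disjSum 𝓛).image g := by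
      intro A hA
      obtain ⟨i, -, rfl⟩ := Finset.mem_image.mp hA
      rw [Finset.mem_image]
      obtain ⟨S, hS | hS⟩ := hpull i
      · refine ⟨Sum.inl S, Finset.inl_mem_disjSum.mpr ?_, hS.symm⟩
        rw [h𝓓, Finset.mem_filter]; exact ⟨Finset.mem_univ _, i, hS⟩
      · refine ⟨Sum.inr S, Finset.inr_mem_disjSum.mpr ?_, hS.symm⟩
        rw [h𝓛, Finset.mem_filter]; exact ⟨Finset.mem_univ _, i, hS⟩
    have h1 := Finset.card_le_card hsub
    rw [Finset.card_image_of_injective _ hu, Finset.card_univ, Fintype.card_fin] at h1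
    have h2 := (Finset.card_image_le (s := 𝓓.disjSum 𝓛) (f := g)).trans_eq (Finset.card_disjSum 𝓓 𝓛)
    omega
  have h𝓦card : r₁ ≤ (𝓓 ∩ 𝓛).card := by
    have hU := Finset.card_le_univ (𝓓 ∪ 𝓛)
    rw [Fintype.card_finset, Fintype.card_fin] at hU
    have := Finset.card_union_add_card_inter 𝓓 𝓛
    omega
  -- ### any `r₁` members of `𝓓 ∩ 𝓛`
  obtain ⟨L', hL'sub, hL'card⟩ := Finset.exists_subset_card_eq h𝓦card
  have hL'c : Fintype.card L' = r₁ := by rw [Fintype.card_coe, hL'card]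
  let ε : L' ≃ Fin r₁ := Fintype.equivFinOfCardEq hL'c
  let w : Fin r₁ → Finset (Fin n) := fun j => (ε.symm j).1
  have hwmem : ∀ j, w j ∈ 𝓓 ∩ 𝓛 := fun j => hL'sub (ε.symm j).2
  have hwinj : Function.Injective w := fun j j' hjj => ε.symm.injective (Subtype.ext hjj)
  -- ### the old design serves `w`; transport
  let w' : Fin r₁ → Finset (Fin (n + 1)) := fun j => (w j).map emb
  let ee : Fin r₁ → Fin m' × Finset (Fin K') := fun k => (ι (e k).1, ((e k).2).map κ)
  have hG : symDet w' ee ≠ 0 :=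
    symGood_map_pieces ι κ w' e (symGood_map_embedding emb w e (hgood w hwinj))
  -- ### the cylinder
  let ucyl : Fin (r₁ + r₁) → Finset (Fin (n + 1)) := Fin.append w' fun j => insert x (w' j)
  let ecyl : Fin (r₁ + r₁) → Fin m' × Finset (Fin K') := Fin.append ee fun j => ((ee j).1, insert mk (ee j).2)
  have hcast : Function.Injective (Sum.elim (Fin.castAdd r₁ : Fin r₁ → Fin (r₁ + r₁)) (Fin.natAdd r₁)) := by
    have : Sum.elim (Fin.castAdd r₁ : Fin r₁ → Fin (r₁ + r₁)) (Fin.natAdd r₁) = ⇑(finSumFinEquiv (m := r₁) (n := r₁)) := by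
      funext i; rcases i with i | i <;> simp
    rw [this]; exact finSumFinEquiv.injective
  have hcyl : symDet ucyl ecyl ≠ 0 := by
    refine symGood_cylinder w' ee x (fun _ => mk) (fun j => hxemb (w j)) ?_ ucyl ecyl rfl
      (Fin.castAdd r₁) (Fin.natAdd r₁) hcast ?_ ?_ ?_ ?_ hG
    · intro k hk
      obtain ⟨q, -, hq⟩ := Finset.mem_map.mp hk
      exact hmk ⟨q, hq⟩
    all_goals intro j; first | exact Fin.append_left _ _ j | exact Fin.append_right _ _ j
  -- ### the cylinder sits inside `(u, e')`
  have hrow0 : ∀ j, ∃ i, u i = w' j := fun j => by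
    have h := (Finset.mem_inter.mp (hwmem j)).1; rw [h𝓓, Finset.mem_filter] at h; exact h.2
  have hrow1 : ∀ j, ∃ i, u i = insert x (w' j) := fun j => by
    have h := (Finset.mem_inter.mp (hwmem j)).2; rw [h𝓛, Finset.mem_filter] at h; exact h.2
  choose ρ₀ hρ₀ using hrow0
  choose ρ₁ hρ₁ using hrow1
  let row : Fin (r₁ + r₁) → Fin r := Fin.append ρ₀ ρ₁
  have hrow : Function.Injective row := by
    refine Fin.append_injective_iff.mpr ⟨?_, ?_, ?_⟩
    · intro j j' hjj
      apply hwinj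
      apply Finset.map_injective emb
      change w' j = w' j'
      rw [← hρ₀ j, ← hρ₀ j', hjj]
    · intro j j' hjj
      apply hwinj
      apply Finset.map_injective emb
      change w' j = w' j'
      have h1 : insert x (w' j) = insert x (w' j') := by rw [← hρ₁ j, ← hρ₁ j', hjj]
      have h2 := congrArg (fun S => Finset.erase S x) h1
      simpa only [Finset.erase_insert (show x ∉ w' j from hxemb (w j)),
        Finset.erase_insert (show x ∉ w' j' from hxemb (w j'))] using h2
    · intro j j' hjj
      have h1 : x ∈ u (ρ₁ j') := by rw [hρ₁]; exact Finset.mem_insert_self _ _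
      rw [← hjj, hρ₀] at h1
      exact hxemb (w j) h1
  let col : Fin (r₁ + r₁) → Fin r := Fin.append g₀ g₁
  have hg01 : Function.Injective (Sum.elim g₀ g₁) := fun a b hab => Sum.inl_injective (hg (a₁ := Sum.inl a) (a₂ := Sum.inl b) hab)
  have hcol : Function.Injective col := by
    refine Fin.append_injective_iff.mpr ⟨?_, ?_, ?_⟩
    · exact fun a b hab => Sum.inl_injective (hg01 (a₁ := Sum.inl a) (a₂ := Sum.inl b) hab)
    · exact fun a b hab => Sum.inr_injective (hg01 (a₁ := Sum.inr a) (a₂ := Sum.inr b) hab)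
    · intro a b hab
      exact Sum.inl_ne_inr (hg01 (a₁ := Sum.inl a) (a₂ := Sum.inr b) hab)
  have hcore : symDet (fun c => u (row c)) (fun c => e' (col c)) ≠ 0 := by
    have hu' : (fun c => u (row c)) = ucyl := by
      funext k
      rcases eq_castAdd_or_natAdd k with ⟨j, rfl⟩ | ⟨j, rfl⟩
      · change u (Fin.append ρ₀ ρ₁ (Fin.castAdd r₁ j)) = Fin.append w' (fun j => insert x (w' j)) (Fin.castAdd r₁ j)
        rw [Fin.append_left, Fin.append_left, hρ₀]
      · change u (Fin.append ρ₀ ρ₁ (Fin.natAdd r₁ j)) = Fin.append w' (fun j => insert x (w' j)) (Fin.natAdd r₁ j)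
        rw [Fin.append_right, Fin.append_right, hρ₁]
    have he' : (fun c => e' (col c)) = ecyl := by
      funext k
      rcases eq_castAdd_or_natAdd k with ⟨j, rfl⟩ | ⟨j, rfl⟩
      · change e' (Fin.append g₀ g₁ (Fin.castAdd r₁ j)) = Fin.append ee (fun j => ((ee j).1, insert mk (ee j).2)) (Fin.castAdd r₁ j)
        rw [Fin.append_left, Fin.append_left, he0]
      · change e' (Fin.append g₀ g₁ (Fin.natAdd r₁ j)) = Fin.append ee (fun j => ((ee j).1, insert mk (ee j).2)) (Fin.natAdd r₁ j)
        rw [Fin.append_right, Fin.append_right, he1]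
    rw [hu', he']
    exact hcyl
  -- ### free points absorb the remaining `c` rows
  refine symGood_goodCore_free u hu e' row col hrow hcol hcore ?_
  intro k hk
  have hbij : Function.Bijective (Sum.elim (Sum.elim g₀ g₁) g₂) := by
    rw [Fintype.bijective_iff_injective_and_card]
    exact ⟨hg, by simp [Fintype.card_sum]; omega⟩
  obtain ⟨s, hs⟩ := hbij.2 k
  rcases s with (j | j) | j
  · exact absurd ⟨Fin.castAdd r₁ j, by change Fin.append g₀ g₁ _ = k; rw [Fin.append_left]; exact hs⟩ hk
  · exact absurd ⟨Fin.natAdd r₁ j, by change Fin.append g₀ g₁ _ = k; rw [Fin.append_right]; exact hs⟩ hk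
  · simp only [Sum.elim_inr] at hs
    subst hs
    exact hfree j

end SymbJoin

end

end Summit.ValiantsHypothesis.ValiantsHypothesis.Theorems.BarrierLever.HiddenStates
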